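import Summits.CriticalPhenomena.CardyFormulaZ2.Theorems.CardySelfRefinementLagHandOffBelowDictionary
import HarnessLib

/-!
# The lattice dictionary at a COLUMN cross-cut approached from the EAST (half turn of the column
dictionary)
(groundwork for stub `stub_tournamentTransfer`, line `hitting-tournament`, crux `LagHandOff`,
stmt-CriticalPhenomena-10268; registered sub-goal stub `stub_tournamentTransfer_eastDictionary`)

Second quarter turn of the exact lattice dictionary "first arrival of the bond-`ℤ²` medial
exploration at a straight cross-cut = extreme cross-cut site of the open cluster of the arc `A`
grown on the near side" (Holden–Sun, arXiv:1905.13207, Prop. 6.25 (1), for G02's medial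
exploration of bond percolation on `δℤ²`, Smirnov 2001 §2).  The tree has it for columns
approached from the west (`stub_tournamentTransfer_columnDictionary`) and, by one quarter turn
`z ↦ i z`, for rows approached from below (`…BelowDictionary`: `columnDictionary_rot`,
`medialExploration_rot`).  Here:

* `belowDictionary_rot` — the second generic transport step: the row-from-below dictionary for
  data `E` gives the column-from-the-EAST dictionary for the turned data `E'` (`E'.Ω = i·E.Ω`,
  same mesh, turned arcs); the level `r` of the row becomes the column `{re = -r}`;
* `stub_tournamentTransfer_eastDictionary` — the registered sub-goal: data on a Dobrushin domain
  are the quarter turn of the data turned thrice, themselves the quarter turn of the data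
  turned twice, which live on a Dobrushin domain (`exists_rot_data_three`) and so satisfy the
  column dictionary (`columnDictionary_of_carrier`); transport twice.

References: S. Smirnov, C. R. Acad. Sci. Paris 333 (2001), §2; G. Grimmett, *Percolation*
(1999), §1.6 (lattice symmetries), §11.2; N. Holden, X. Sun, arXiv:1905.13207, Prop. 6.25.
-/

noncomputable section

open Set
open Literature.Probability.Percolation Literature.Probability.LatticeModels
open Literature.Probability.RandomPlanarGeometry

namespace Summit.CriticalPhenomena.CardyFormulaZ2.Cruxes.LagHandOff.HittingTournament

/-! ### The second transport step: rows from below ⟹ columns from the east -/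

section Data

variable {E E' : DiscreteDobrushin}
  (hΩ : E'.Ω = (fun z => Complex.I * z) '' E.Ω) (hδ : E'.δ = E.δ)
  (hA : E'.arcA = (fun z => Complex.I * z) '' E.arcA)
  (hB : E'.arcB = (fun z => Complex.I * z) '' E.arcB)

include hΩ hδ hA hB

/-- **The second transport step: row-from-below dictionary for `E` ⟹ column-from-the-east
dictionary for the turned data `E'`.**  Along `x ↦ rotCell x` one has `(rotCell x) 0 = -x 1`,
so the row `{im = r}` approached from below is carried onto the column `{re = -r}` approached
from the east, the half-plane `{x 1 + y 1 < 2r}` of edges onto `{-2r < x 0 + y 0}`, the unit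
vector `cornerUnit 0` onto `cornerUnit 1` and `cornerUnit 2` onto `cornerUnit 3`; restricted
open connections, the graph `Ω_δ` and the exploration are transported by
`relabel_inter_mem_openConnIn_iff`, `adj_rot_iff`, `medialExploration_rot`.
[cite: Smirnov2001, §2] -/
theorem belowDictionary_rot (hE : E.IsZdAdmissible)
    (hBd : ∀ (c₀ : Site 2 × Fin 4) (ω : BondConfig (Site 2)) (r : ℤ), E.IsStartCorner c₀ →
      c₀.1 1 < r → (∃ e ∈ medialExploration E ω, ∀ x y : Site 2, e = s(x, y) → 2 * r ≤ x 1 + y 1) →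
      ∃ (τ : ℕ) (v : Site 2), τ + 2 < (medialExploration E ω).length ∧ v 1 = r ∧
        (medialExploration E ω)[τ + 2]? = some s(v, v + cornerUnit 0) ∧
        (∀ i < τ + 2, ∀ x y : Site 2, (medialExploration E ω)[i]? = some s(x, y) →
          x 1 + y 1 < 2 * r) ∧
        E.bcBondConfig ω ∩ {e | ∀ x y : Site 2, e = s(x, y) → x 1 + y 1 < 2 * r} ∈
          openConnIn {u : Site 2 | u 1 ≤ r} c₀.1 v ∧
        ∀ w : Site 2, w 1 = r → v 0 < w 0 →
          (∀ z : Site 2, z 1 = r → v 0 < z 0 → z 0 ≤ w 0 →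
            (discreteDomainGraph E.Ω E.δ).Adj z (z + cornerUnit 2)) →
          ∀ S : Set (Site 2), E.bcBondConfig ω ∩
            {e | ∀ x y : Site 2, e = s(x, y) → x 1 + y 1 < 2 * r} ∉ openConnIn S c₀.1 w)
    (c₀ : Site 2 × Fin 4) (ω : BondConfig (Site 2)) (m : ℤ) (hc₀ : E'.IsStartCorner c₀)
    (hside : m < c₀.1 0)
    (hfar : ∃ e ∈ medialExploration E' ω, ∀ x y : Site 2, e = s(x, y) → x 0 + y 0 ≤ 2 * m) :
    ∃ (τ : ℕ) (v : Site 2), τ + 2 < (medialExploration E' ω).length ∧ v 0 = m ∧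
      (medialExploration E' ω)[τ + 2]? = some s(v, v + cornerUnit 1) ∧
      (∀ i < τ + 2, ∀ x y : Site 2, (medialExploration E' ω)[i]? = some s(x, y) →
        2 * m < x 0 + y 0) ∧
      E'.bcBondConfig ω ∩ {e | ∀ x y : Site 2, e = s(x, y) → 2 * m < x 0 + y 0} ∈
        openConnIn {u : Site 2 | m ≤ u 0} c₀.1 v ∧
      ∀ w : Site 2, w 0 = m → v 1 < w 1 →
        (∀ z : Site 2, z 0 = m → v 1 < z 1 → z 1 ≤ w 1 →
          (discreteDomainGraph E'.Ω E'.δ).Adj z (z + cornerUnit 3)) →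
        ∀ S : Set (Site 2), E'.bcBondConfig ω ∩
          {e | ∀ x y : Site 2, e = s(x, y) → 2 * m < x 0 + y 0} ∉ openConnIn S c₀.1 w := by
  -- adapted from `columnDictionary_rot` of `…BelowDictionary` (one more quarter turn)
  -- pull the start corner and the configuration back to `E`
  obtain ⟨a', d'⟩ := c₀
  obtain ⟨a, rfl⟩ := rotCell.surjective a'
  obtain ⟨d, rfl⟩ : ∃ d, d + 1 = d' := ⟨d' + 3, fin4_add_three_add_one d'⟩
  obtain ⟨ω₀, rfl⟩ := (BondConfig.relabel (sym2Equiv rotCell)).surjective ω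
  have hc : E.IsStartCorner (a, d) := (isStartCorner_rot_iff hΩ hδ hA hB (a, d)).1 hc₀
  have hmE := medialExploration_rot hΩ hδ hA hB hE hc ω₀
  have hside' : a 1 < -m := by
    simp only [rotCell_apply_zero] at hside
    omega
  -- the set of edges strictly below the row `{im = -m}` is turned onto that strictly east of
  -- the column `{re = m}`
  have hset : sym2Equiv rotCell '' {e | ∀ x y : Site 2, e = s(x, y) → x 1 + y 1 < 2 * -m} =
      {e | ∀ x y : Site 2, e = s(x, y) → 2 * m < x 0 + y 0} :=
    sym2Equiv_rot_image_setOf (fun x y => by simp only [rotCell_apply_zero]; omega)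
      (fun x y h => by omega) (fun x y h => by omega)
  have hpre : rotCell ⁻¹' {u : Site 2 | m ≤ u 0} = {u : Site 2 | u 1 ≤ -m} := by
    ext u
    simp only [Set.mem_preimage, Set.mem_setOf_eq, rotCell_apply_zero]
    omega
  rw [hmE] at hfar ⊢
  -- the far medial vertex, pulled back
  have hfar₀ : ∃ e ∈ medialExploration E ω₀, ∀ x y : Site 2, e = s(x, y) → 2 * -m ≤ x 1 + y 1 := by
    obtain ⟨e', he', hfar'⟩ := hfar
    obtain ⟨e, he, rfl⟩ := List.mem_map.1 he'
    refine ⟨e, he, fun x y hxy => ?_⟩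
    have h := hfar' (rotCell x) (rotCell y) (by rw [hxy]; rfl)
    simp only [rotCell_apply_zero] at h
    omega
  obtain ⟨τ, v, hlen, hv, hhit, hbefore, hleft, hmin⟩ := hBd (a, d) ω₀ (-m) hc hside' hfar₀
  refine ⟨τ, rotCell v, ?_, ?_, ?_, ?_, ?_, ?_⟩
  · rwa [List.length_map]
  · simp only [rotCell_apply_zero]
    omega
  · rw [List.getElem?_map, hhit, Option.map_some, sym2Equiv_mk, rotCell_add, rotCell_cornerUnit]
    rfl
  · intro i hi x' y' h
    obtain ⟨x, rfl⟩ := rotCell.surjective x'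
    obtain ⟨y, rfl⟩ := rotCell.surjective y'
    rw [List.getElem?_map, Option.map_eq_some_iff] at h
    obtain ⟨e, he, hexy⟩ := h
    have hexy' : e = s(x, y) := (sym2Equiv rotCell).injective (by rw [hexy]; rfl)
    have h := hbefore i hi x y (by rw [he, hexy'])
    simp only [rotCell_apply_zero]
    omega
  · show _ ∈ openConnIn _ (rotCell a) (rotCell v)
    rw [bcBondConfig_rot hΩ hδ hA hB, relabel_inter_mem_openConnIn_iff _ _ _ hset, hpre]
    exact hleft
  · intro w' hw' hvw' hseg S
    obtain ⟨w, rfl⟩ := rotCell.surjective w'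
    have hw : w 1 = -m := by
      simp only [rotCell_apply_zero] at hw'
      omega
    have hvw : v 0 < w 0 := by simpa using hvw'
    have hseg₀ : ∀ z : Site 2, z 1 = -m → v 0 < z 0 → z 0 ≤ w 0 →
        (discreteDomainGraph E.Ω E.δ).Adj z (z + cornerUnit 2) := by
      intro z hz0 hz1 hz2
      have h := hseg (rotCell z) (by simp only [rotCell_apply_zero]; omega)
        (by simpa using hz1) (by simpa using hz2)
      rw [show rotCell z + cornerUnit 3 = rotCell (z + cornerUnit 2) by
        rw [rotCell_add, rotCell_cornerUnit]; rfl, adj_rot_iff hΩ hδ] at h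
      exact h
    show _ ∉ openConnIn _ (rotCell a) (rotCell w)
    rw [bcBondConfig_rot hΩ hδ hA hB, relabel_inter_mem_openConnIn_iff _ _ _ hset]
    exact hmin w hw hvw hseg₀ _

end Data

/-! ### The registered sub-goal -/

/-- **Registered sub-goal stub `stub_tournamentTransfer_eastDictionary`: the lattice dictionary at
a COLUMN cross-cut `{re = m}` approached from the EAST, for admissible data on a Dobrushin
domain.**  For a start corner strictly east of the column (`m < c₀.1 0`) and an exploration that
does not stay in `{re > m}`: the FIRST medial vertex of the exploration on the column is the
vertical edge `{v, v + e₁}` above a column site `v` (all earlier ones lie in `{re > m}`); `v` is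
joined to the `A`-end `c₀.1` of `e_a` by open edges of `{re > m}`; and no column site strictly
ABOVE `v` on the same column segment of `Ω_δ` is so joined (Holden–Sun Prop. 6.25 (1) for the
bond-`ℤ²` medial exploration, half turn of the column-from-the-west case).  Proof: the data are
the quarter turn of the data turned thrice, themselves the quarter turn of admissible data on a
Dobrushin domain (`exists_rot_data_three`) satisfying the column dictionary
(`columnDictionary_of_carrier`); transport by `columnDictionary_rot`, then by
`belowDictionary_rot`. [cite: Smirnov2001, §2] -/
theorem stub_tournamentTransfer_eastDictionary : ∀ (D : DobrushinDomain) (E : DiscreteDobrushin) (c₀ : Site 2 × Fin 4) (ω : BondConfig (Site 2)) (m : ℤ), E.Ω = D.carrier → E.IsZdAdmissible → E.IsStartCorner c₀ → m < c₀.1 0 → (∃ e ∈ medialExploration E ω, ∀ x y : Site 2, e = s(x, y) → x 0 + y 0 ≤ 2 * m) → ∃ (τ : ℕ) (v : Site 2), τ + 2 < (medialExploration E ω).length ∧ v 0 = m ∧ (medialExploration E ω)[τ + 2]? = some s(v, v + cornerUnit 1) ∧ (∀ i < τ + 2, ∀ x y : Site 2, (medialExploration E ω)[i]? = some s(x, y)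 → 2 * m < x 0 + y 0) ∧ E.bcBondConfig ω ∩ {e | ∀ x y : Site 2, e = s(x, y) → 2 * m < x 0 + y 0} ∈ openConnIn {u : Site 2 | m ≤ u 0} c₀.1 v ∧ ∀ w : Site 2, w 0 = m → v 1 < w 1 → (∀ z : Site 2, z 0 = m → v 1 < z 1 → z 1 ≤ w 1 → (discreteDomainGraph E.Ω E.δ).Adj z (z + cornerUnit 3)) → ∀ S : Set (Site 2), E.bcBondConfig ω ∩ {e | ∀ x y : Site 2, e = s(x, y) → 2 * m < x 0 + y 0} ∉ openConnIn S c₀.1 w := by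
  intro D E c₀ ω m hΩD hE hc₀ hside hfar
  obtain ⟨-, D₂, -, -, E₂, E₃, -, ⟨hΩ₂, hE₂⟩, ⟨-, hE₃⟩, -, -, ⟨h3Ω, h3δ, h3A, h3B⟩,
    h4Ω, h4δ, h4A, h4B⟩ := exists_rot_data_three D hΩD hE
  exact belowDictionary_rot h4Ω h4δ h4A h4B hE₃
    (columnDictionary_rot h3Ω h3δ h3A h3B hE₂ (columnDictionary_of_carrier D₂ hΩ₂ hE₂))
    c₀ ω m hc₀ hside hfar

end Summit.CriticalPhenomena.CardyFormulaZ2.Cruxes.LagHandOff.HittingTournament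

end
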